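import Summits.ValiantsHypothesis.ValiantsHypothesis.Theorems.KPlusLogSqLawTropicalBToeplitzMorphSlackA
import Summits.ValiantsHypothesis.ValiantsHypothesis.Theorems.KPlusLogSqLawTropicalBToeplitzMorphSlackB
import Summits.ValiantsHypothesis.ValiantsHypothesis.Theorems.KPlusLogSqLawTropicalBToeplitzMorphSlackC

/-!
# Route `KPlusLogSqLaw`, crux `TropicalB` — Toeplitz sector: the MORPH THEOREM's dual feasibility (odd members), assembled from the leaves (opposite sides)

HONEST FRAMING.  Helper toward the registered stubs `stub_tropThin` / `stub_tropFat` (crux `…Theses.KPlusLogSqLaw.TropicalB`, item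
`stmt-ValiantsHypothesis-19771`; cell `pub-symmetroid`, seat `val-sym-trop-p4` (g23), 2026-08-29).  For the closed-form potential `f` of the
morph member `μ_j`, `j = 2h+1`, `1 ≤ j ≤ q − 1` (given ABSTRACTLY by its five zone formulas `hf1e … hf5`, so that this file is definition-free),
with `K = 4q+4h+3` and `c = T + (2q+2h+1)(q+h+1)`, `T = 4qh + q − 2h² − 3h`:
* `morph_feasible_diag`: `2 f(x) + 1 ≤ c` (fixed points are never tight);
* `morph_feasible_same`: for `0 ≤ x < y ≤ 2q−1` (two positions on the same side of the centre, distance `d = y − x`):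
  `f x + f y + d(K − 2d) ≤ c`, with equality only on the explicit tight loci (the A–B ladder `y − x ∈ {q, q+1}` and the zipper rungs);
* `morph_feasible_opp`: for `0 ≤ x ≤ y ≤ 2q−1` on opposite sides (`d = x + y + 1`): the same with the loci `x + y = q + 2h` (B–E) and the
  zipper rungs.
Every case is one leaf of `…ToeplitzMorphSlackA/B/C` (machine-found Handelman certificates); the zone dispatch here is generated
(HOME/val-sym-trop-p4/g23/tools/cert/leandisp.py).  Used by `…ToeplitzMorphMember`.  Nothing here bounds `Φ_Toep` from above;
`ConjectureTPoly` / `TropicalB` stay OPEN; nothing on `MatrixDescartes` or `VP ≠ VNP`.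
-/

set_option linter.dupNamespace false
set_option autoImplicit false

namespace Summit.ValiantsHypothesis.ValiantsHypothesis.Theorems.KPlusLogSqLaw.Toeplitz

set_option maxHeartbeats 1600000 in
/-- **Opposite sides**: for `0 ≤ x ≤ y ≤ 2q−1` and `d = x + y + 1`, `f x + f y + d(K−2d) ≤ c`, with equality only on the tight loci
(B–E pairs `x + y = q + 2h` with `x, y` in zone Z2; zipper rungs `x = 2t, y = q+h−t` and `x = 2t+1, y = q+h−1−t`). [folklore] -/
theorem morph_feasible_opp (q h : ℤ) (hq : 2 * h + 2 ≤ q) (hh : 0 ≤ h) (f : ℤ → ℤ)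
    (hf1e : ∀ t : ℤ, 0 ≤ t → t ≤ h → f (2 * t) = (4)*t^2)
    (hf1o : ∀ t : ℤ, 0 ≤ t → t + 1 ≤ h → f (2 * t + 1) = (4)*t^2 + (4)*t + (1))
    (hf2 : ∀ x : ℤ, 2 * h + 1 ≤ x → x ≤ q - 1 → f x = (4)*h*x + (-4)*h^2 + (-2)*h + (1)*x)
    (hf3 : ∀ x : ℤ, q ≤ x → x ≤ q + h → f x = (4)*h*x + (-4)*h^2 + (4)*q*x + (-2)*q^2 + (-2)*x^2 + (-2)*h + (2)*q + (-1)*x)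
    (hf4 : ∀ x : ℤ, q + h + 1 ≤ x → x ≤ q + 2 * h + 1 → f x = (4)*h*x + (-4)*h^2 + (4)*q*x + (-2)*q^2 + (-2)*x^2 + (-6)*h + (-2)*q + (3)*x + (-1))
    (hf5 : ∀ x : ℤ, q + 2 * h + 2 ≤ x → x ≤ 2 * q - 1 → f x = (8)*h*q + (-4)*h*x + (4)*h^2 + (2)*h + (2)*q + (-1)*x + (1))
    (x y d : ℤ) (hx0 : 0 ≤ x) (hxy : x ≤ y) (hy1 : y ≤ 2 * q - 1) (hd : d = x + y + 1) :
    f x + f y + d * ((4 * q + 4 * h + 3) - 2 * d) ≤ (8)*h*q + (2)*q^2 + (4)*q + (1) ∧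
      (f x + f y + d * ((4 * q + 4 * h + 3) - 2 * d) = (8)*h*q + (2)*q^2 + (4)*q + (1) →
        ((2 * h + 1 ≤ x ∧ x ≤ q - 1 ∧ 2 * h + 1 ≤ y ∧ y ≤ q - 1 ∧ x + y = q + 2 * h) ∨ (∃ t : ℤ, x = 2 * t ∧ 0 ≤ t ∧ t ≤ h ∧ y = q + h - t) ∨ (∃ t : ℤ, x = 2 * t + 1 ∧ 0 ≤ t ∧ t + 1 ≤ h ∧ y = q + h - 1 - t))) := by
    rcases le_or_gt y (2 * h) with Z1 | Z1
    · obtain ⟨u, hpar⟩ := Int.even_or_odd' y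
      rcases hpar with rfl | rfl
      · rcases le_or_gt x (2 * h) with Z1 | Z1
        · obtain ⟨t, hpar⟩ := Int.even_or_odd' x
          rcases hpar with rfl | rfl
          · have L := morphSlack_1e1eopp q h t u d (by omega) (by omega) (by omega) (by omega)
            have HX := hf1e t (by omega) (by omega)
            have HY := hf1e u (by omega) (by omega)
            exact ⟨by linarith [L, HX, HY], fun heq => by exfalso; linarith [L, HX, HY, heq]⟩
          · have L := morphSlack_1o1eopp q h t u d (by omega) (by omega) (by omega) (by omega)
            have HX := hf1o t (by omega) (by omega)
            have HY := hf1e u (by omega) (by omega)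
            exact ⟨by linarith [L, HX, HY], fun heq => by exfalso; linarith [L, HX, HY, heq]⟩
        · rcases le_or_gt x (q - 1) with Z2 | Z2
          · exact False.elim (by omega)
          · rcases le_or_gt x (q + h) with Z3 | Z3
            · exact False.elim (by omega)
            · rcases le_or_gt x (q + 2 * h + 1) with Z4 | Z4
              · exact False.elim (by omega)
              · exact False.elim (by omega)
      · rcases le_or_gt x (2 * h) with Z1 | Z1
        · obtain ⟨t, hpar⟩ := Int.even_or_odd' x
          rcases hpar with rfl | rfl
          · have L := morphSlack_1e1oopp q h t u d (by omega) (by omega) (by omega) (by omega)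
            have HX := hf1e t (by omega) (by omega)
            have HY := hf1o u (by omega) (by omega)
            exact ⟨by linarith [L, HX, HY], fun heq => by exfalso; linarith [L, HX, HY, heq]⟩
          · have L := morphSlack_1o1oopp q h t u d (by omega) (by omega) (by omega) (by omega)
            have HX := hf1o t (by omega) (by omega)
            have HY := hf1o u (by omega) (by omega)
            exact ⟨by linarith [L, HX, HY], fun heq => by exfalso; linarith [L, HX, HY, heq]⟩
        · rcases le_or_gt x (q - 1) with Z2 | Z2
          · exact False.elim (by omega)
          · rcases le_or_gt x (q + h) with Z3 | Z3
            · exact False.elim (by omega)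
            · rcases le_or_gt x (q + 2 * h + 1) with Z4 | Z4
              · exact False.elim (by omega)
              · exact False.elim (by omega)
    · rcases le_or_gt y (q - 1) with Z2 | Z2
      · rcases le_or_gt x (2 * h) with Z1 | Z1
        · obtain ⟨t, hpar⟩ := Int.even_or_odd' x
          rcases hpar with rfl | rfl
          · have L := morphSlack_1e2opp q h t y d (by omega) (by omega) (by omega)
            have HX := hf1e t (by omega) (by omega)
            have HY := hf2 y (by omega) (by omega)
            exact ⟨by linarith [L, HX, HY], fun heq => by exfalso; linarith [L, HX, HY, heq]⟩
          · have L := morphSlack_1o2opp q h t y d (by omega) (by omega) (by omega)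
            have HX := hf1o t (by omega) (by omega)
            have HY := hf2 y (by omega) (by omega)
            exact ⟨by linarith [L, HX, HY], fun heq => by exfalso; linarith [L, HX, HY, heq]⟩
        · rcases le_or_gt x (q - 1) with Z2 | Z2
          · rcases lt_trichotomy (x + y) (q + 2 * h) with c1 | c1 | c1
            · have L := morphSlack_22opp_lt q h x y d (by omega) (by omega)
              have HX := hf2 x (by omega) (by omega)
              have HY := hf2 y (by omega) (by omega)
              exact ⟨by linarith [L, HX, HY], fun heq => by exfalso; linarith [L, HX, HY, heq]⟩
            · have L := morphSlack_22opp_eq q h x y d (by omega) (by omega)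
              have HX := hf2 x (by omega) (by omega)
              have HY := hf2 y (by omega) (by omega)
              exact ⟨by linarith [L, HX, HY], fun _ => Or.inl ⟨by omega, by omega, by omega, by omega, by omega⟩⟩
            · have L := morphSlack_22opp_gt q h x y d (by omega) (by omega)
              have HX := hf2 x (by omega) (by omega)
              have HY := hf2 y (by omega) (by omega)
              exact ⟨by linarith [L, HX, HY], fun heq => by exfalso; linarith [L, HX, HY, heq]⟩
          · rcases le_or_gt x (q + h) with Z3 | Z3
            · exact False.elim (by omega)
            · rcases le_or_gt x (q + 2 * h + 1) with Z4 | Z4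
              · exact False.elim (by omega)
              · exact False.elim (by omega)
      · rcases le_or_gt y (q + h) with Z3 | Z3
        · rcases le_or_gt x (2 * h) with Z1 | Z1
          · obtain ⟨t, hpar⟩ := Int.even_or_odd' x
            rcases hpar with rfl | rfl
            · rcases lt_trichotomy y (q + h - t) with c1 | c1 | c1
              · have L := morphSlack_1e3opp_lt q h t y d (by omega) (by omega)
                have HX := hf1e t (by omega) (by omega)
                have HY := hf3 y (by omega) (by omega)
                exact ⟨by linarith [L, HX, HY], fun heq => by exfalso; linarith [L, HX, HY, heq]⟩
              · have L := morphSlack_1e3opp_eq q h t y d (by omega) (by omega)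
                have HX := hf1e t (by omega) (by omega)
                have HY := hf3 y (by omega) (by omega)
                exact ⟨by linarith [L, HX, HY], fun _ => Or.inr (Or.inl ⟨t, rfl, by omega, by omega, by omega⟩)⟩
              · have L := morphSlack_1e3opp_gt q h t y d (by omega) (by omega)
                have HX := hf1e t (by omega) (by omega)
                have HY := hf3 y (by omega) (by omega)
                exact ⟨by linarith [L, HX, HY], fun heq => by exfalso; linarith [L, HX, HY, heq]⟩
            · rcases lt_trichotomy y (q + h - 1 - t) with c1 | c1 | c1
              · have L := morphSlack_1o3opp_lt q h t y d (by omega) (by omega)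
                have HX := hf1o t (by omega) (by omega)
                have HY := hf3 y (by omega) (by omega)
                exact ⟨by linarith [L, HX, HY], fun heq => by exfalso; linarith [L, HX, HY, heq]⟩
              · have L := morphSlack_1o3opp_eq q h t y d (by omega) (by omega)
                have HX := hf1o t (by omega) (by omega)
                have HY := hf3 y (by omega) (by omega)
                exact ⟨by linarith [L, HX, HY], fun _ => Or.inr (Or.inr ⟨t, rfl, by omega, by omega, by omega⟩)⟩
              · have L := morphSlack_1o3opp_gt q h t y d (by omega) (by omega)
                have HX := hf1o t (by omega) (by omega)
                have HY := hf3 y (by omega) (by omega)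
                exact ⟨by linarith [L, HX, HY], fun heq => by exfalso; linarith [L, HX, HY, heq]⟩
          · rcases le_or_gt x (q - 1) with Z2 | Z2
            · have L := morphSlack_23opp q h x y d (by omega) (by omega) (by omega)
              have HX := hf2 x (by omega) (by omega)
              have HY := hf3 y (by omega) (by omega)
              exact ⟨by linarith [L, HX, HY], fun heq => by exfalso; linarith [L, HX, HY, heq]⟩
            · rcases le_or_gt x (q + h) with Z3 | Z3
              · have L := morphSlack_33opp q h x y d (by omega) (by omega) (by omega) (by omega)
                have HX := hf3 x (by omega) (by omega)
                have HY := hf3 y (by omega) (by omega)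
                exact ⟨by linarith [L, HX, HY], fun heq => by exfalso; linarith [L, HX, HY, heq]⟩
              · rcases le_or_gt x (q + 2 * h + 1) with Z4 | Z4
                · exact False.elim (by omega)
                · exact False.elim (by omega)
        · rcases le_or_gt y (q + 2 * h + 1) with Z4 | Z4
          · rcases le_or_gt x (2 * h) with Z1 | Z1
            · obtain ⟨t, hpar⟩ := Int.even_or_odd' x
              rcases hpar with rfl | rfl
              · have L := morphSlack_1e4opp q h t y d (by omega) (by omega) (by omega)
                have HX := hf1e t (by omega) (by omega)
                have HY := hf4 y (by omega) (by omega)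
                exact ⟨by linarith [L, HX, HY], fun heq => by exfalso; linarith [L, HX, HY, heq]⟩
              · have L := morphSlack_1o4opp q h t y d (by omega) (by omega) (by omega)
                have HX := hf1o t (by omega) (by omega)
                have HY := hf4 y (by omega) (by omega)
                exact ⟨by linarith [L, HX, HY], fun heq => by exfalso; linarith [L, HX, HY, heq]⟩
            · rcases le_or_gt x (q - 1) with Z2 | Z2
              · have L := morphSlack_24opp q h x y d (by omega) (by omega) (by omega) (by omega)
                have HX := hf2 x (by omega) (by omega)
                have HY := hf4 y (by omega) (by omega)
                exact ⟨by linarith [L, HX, HY], fun heq => by exfalso; linarith [L, HX, HY, heq]⟩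
              · rcases le_or_gt x (q + h) with Z3 | Z3
                · have L := morphSlack_34opp q h x y d (by omega) (by omega) (by omega) (by omega) (by omega) (by omega)
                  have HX := hf3 x (by omega) (by omega)
                  have HY := hf4 y (by omega) (by omega)
                  exact ⟨by linarith [L, HX, HY], fun heq => by exfalso; linarith [L, HX, HY, heq]⟩
                · rcases le_or_gt x (q + 2 * h + 1) with Z4 | Z4
                  · have L := morphSlack_44opp q h x y d (by omega) (by omega) (by omega) (by omega) (by omega) (by omega) (by omega) (by omega)
                    have HX := hf4 x (by omega) (by omega)
                    have HY := hf4 y (by omega) (by omega)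
                    exact ⟨by linarith [L, HX, HY], fun heq => by exfalso; linarith [L, HX, HY, heq]⟩
                  · exact False.elim (by omega)
          · rcases le_or_gt x (2 * h) with Z1 | Z1
            · obtain ⟨t, hpar⟩ := Int.even_or_odd' x
              rcases hpar with rfl | rfl
              · have L := morphSlack_1e5opp q h t y d (by omega) (by omega) (by omega) (by omega)
                have HX := hf1e t (by omega) (by omega)
                have HY := hf5 y (by omega) (by omega)
                exact ⟨by linarith [L, HX, HY], fun heq => by exfalso; linarith [L, HX, HY, heq]⟩
              · have L := morphSlack_1o5opp q h t y d (by omega) (by omega) (by omega) (by omega)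
                have HX := hf1o t (by omega) (by omega)
                have HY := hf5 y (by omega) (by omega)
                exact ⟨by linarith [L, HX, HY], fun heq => by exfalso; linarith [L, HX, HY, heq]⟩
            · rcases le_or_gt x (q - 1) with Z2 | Z2
              · have L := morphSlack_25opp q h x y d (by omega) (by omega) (by omega) (by omega)
                have HX := hf2 x (by omega) (by omega)
                have HY := hf5 y (by omega) (by omega)
                exact ⟨by linarith [L, HX, HY], fun heq => by exfalso; linarith [L, HX, HY, heq]⟩
              · rcases le_or_gt x (q + h) with Z3 | Z3
                · have L := morphSlack_35opp q h x y d (by omega) (by omega) (by omega) (by omega) (by omega) (by omega) (by omega)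
                  have HX := hf3 x (by omega) (by omega)
                  have HY := hf5 y (by omega) (by omega)
                  exact ⟨by linarith [L, HX, HY], fun heq => by exfalso; linarith [L, HX, HY, heq]⟩
                · rcases le_or_gt x (q + 2 * h + 1) with Z4 | Z4
                  · have L := morphSlack_45opp q h x y d (by omega) (by omega) (by omega) (by omega) (by omega) (by omega) (by omega)
                    have HX := hf4 x (by omega) (by omega)
                    have HY := hf5 y (by omega) (by omega)
                    exact ⟨by linarith [L, HX, HY], fun heq => by exfalso; linarith [L, HX, HY, heq]⟩
                  · have L := morphSlack_55opp q h x y d (by omega) (by omega) (by omega) (by omega) (by omega)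
                    have HX := hf5 x (by omega) (by omega)
                    have HY := hf5 y (by omega) (by omega)
                    exact ⟨by linarith [L, HX, HY], fun heq => by exfalso; linarith [L, HX, HY, heq]⟩

end Summit.ValiantsHypothesis.ValiantsHypothesis.Theorems.KPlusLogSqLaw.Toeplitz
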